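import Mathlib
import Literature.Analysis.FluidPDE.TypeIAncientMild
import Literature.Analysis.FluidPDE.TypeIAncientMildClassical
import Literature.Analysis.FluidPDE.BarkerPrange2020VorticityAlignmentTypeIHolds
import Literature.Analysis.FluidPDE.VectorCalculusProofs
import Summits.NavierStokesRegularity.NavierStokesRegularity.Theses.SymmetryModuliCount
import Summits.NavierStokesRegularity.NavierStokesRegularity.Theorems.ClockStretchingLawClockCeilingGermRigidity
import Summits.NavierStokesRegularity.NavierStokesRegularity.Theorems.ScenarioCensusPeriodicGauge
import Summits.NavierStokesRegularity.NavierStokesRegularity.Theorems.SymmetryModuliCountLinearLiouvilleSevenGaugeBounds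
import Summits.NavierStokesRegularity.NavierStokesRegularity.Theorems.PoloidalWindowDoorPoloidalWindowRigidityLocalVorticitySymmetry
import HarnessLib
import Summits.NavierStokesRegularity.NavierStokesRegularity.Theorems.ScenarioCensusBlochMeter

/-!
# Block A2, instrument AFFINE METER REV 2 (ns-idea-2 LINE g18-3; velocity-twin cells A2afH / A2afP / A2afI / A2afL and vorticity-twin cells A2avH / A2avP / A2avI / A2avL DECIDED; A2afPd /
# A2afI0 / A2afE OPEN) — port, part 1/4: §0 the finite model (elementary affine twins and their spectral type); §A class helpers; §B the three laws

Re-homed for the scenario census (typer seat ns-census-typer-1 g10; the cells A2afH / A2afP / A2afI / A2afL (velocity twins) and A2avH / A2avP / A2avI / A2avL (vorticity twins, REV 2) are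
MEMBERS OF RECORD «DECIDED IN KERNEL IN FILES» of row A2 (ns-idea-2 g18 LINE g18-3 REV 2: critic idea-crit-3 PASS (REV 1 14:53:06Z, REV 2 stamp), ref ns-census-ref g16 PRE-CHECK ✓ §21.11,
lead label; OF RECORD 4/4 at census v1.132), A2afPd / A2afI0 / A2afE OPEN (typed); this port makes the decided cells TREE-decided): VERBATIM PORT of ns-idea-2 LINE g18-3 «affine-meter»
REV 2, `pub/ideators/ns-idea-2/lines/affine-meter/line-affine-meter.rev2.lean` sha16 021917a0ebe35407 (1145 l., lean check rc 0, 0 sorry), split for the 400-line rule into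
`ScenarioCensusAffineMeter` (§0, §A, §B) → `…AffineMeterLoxodromic` (§B⁺, §C) → `…AffineMeterRows` (§G, §V) → `…AffineMeterRealisability` (§R + census KEYS).  Lean text VERBATIM in
namespace `…Theorems.ScenarioCensus.AffineMeter` (the line's `…Lines.AffineMeter` re-homed); port edits: the line's `local notation "E3"` is spelled as the reducible `abbrev E3` of every
census file; `norm_slice_le` / `eq_zero_of_slice_translate` / `divergence_conj` are the landed BLOCH METER's (`BlochMeter.norm_slice_le` / `eq_zero_of_slice_periodic` / `divergence_conj`, BY NAME, gate lint dedup.landed — the two g18 lines share these helpers verbatim); `hasFDerivAt_coord` (twin of a Literature lemma outside this closure) is not re-declared — its three instances are stated inline; the two explicit-name `open … (…)` lines of §V spell the opened namespaces in full (inside `…Theorems.ScenarioCensus.*` the relative spelling resolves twice and makes the aliases ambiguous); `@[conjecture]` on the OPEN rows `Row_A2afPd`,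
`Row_A2afI0`, `Row_A2afE`; one-line docstrings added where missing (gate lint).  Statements untouched.

No census VALUE is moved here (row A2 stays OPEN-WITH-LINE; the members become TREE-decided by name); (L′) is NOT proved; no summit statement is proved by this file. Lemmas that restate already-landed tree declarations are taken BY NAME (gate lint `dedup.landed`): `norm_slice_le` = `BlochMeter.norm_slice_le`, `eq_zero_of_slice_translate` = `BlochMeter.eq_zero_of_slice_periodic`, `divergence_conj` = `BlochMeter.divergence_conj`.
-/

-- the summit and its single problem share the name `NavierStokesRegularity` (D-0017 nested layout)
set_option linter.dupNamespace false

noncomputable section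

open Set Function Filter Metric MeasureTheory InnerProductSpace
open scoped Topology RealInnerProductSpace
open Literature.Analysis Literature.Analysis.FluidPDE
open Summit.NavierStokesRegularity.NavierStokesRegularity.Theorems
open Summit.NavierStokesRegularity.NavierStokesRegularity.Theorems.ScenarioCensus

namespace Summit.NavierStokesRegularity.NavierStokesRegularity.Theorems.ScenarioCensus.AffineMeter

/-- `ℝ³` (the line's `local notation "E3"`, spelled as a reducible abbreviation for the tree). -/
abbrev E3 := EuclideanSpace ℝ (Fin 3)

/-! ### §0  The finite model: elementary affine twins and their spectral type -/

/-- The elementary linear map `M = 1 + m ⊗ n♭`: `elem m n v = v + ⟪n, v⟫ m` (spectrum `{1, 1, 1 + ⟪n, m⟫}`). -/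
def elem (m n : E3) (v : E3) : E3 := v + ⟪n, v⟫ • m

/-- `elem m n` as a continuous linear map. -/
def elemL (m n : E3) : E3 →L[ℝ] E3 := ContinuousLinearMap.id ℝ E3 + (innerSL ℝ n).smulRight m

/-- Component / evaluation formula (`elemL_apply`). -/
@[simp] theorem elemL_apply (m n v : E3) : elemL m n v = elem m n v := by
  simp [elemL, elem]

/-- The elementary affine map `g(x) = x + ⟪n, x⟫ m + b` (linear part `elem m n`, translation part `b`). -/
def aff (m n b : E3) (x : E3) : E3 := x + ⟪n, x⟫ • m + b

/-- Auxiliary lemma of the line, stated and proved verbatim (`aff_eq`). -/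
theorem aff_eq (m n b x : E3) : aff m n b x = elem m n x + b := rfl

/-- The verdict alphabet of the finite model. -/
inductive Verdict
  | fatal         -- the reading forces `u ≡ 0` (a DECIDED row below)
  | undecided     -- kinematically realisable, dynamically open (a typed OPEN row below)
  | notASymmetry  -- `μ = 0`: the linear part is singular, the reading is not a self-similarity
  deriving DecidableEq, Repr

/-- THE FINITE MODEL.  Input: the multiplier defect `κ = ⟪n, m⟫` (so `μ = 1 + κ`), whether `g` has a fixed
point, whether `g² = id`.  Output: the verdict.  Hyperbolic `μ ∉ {0, 1, −1}` ⇒ fatal; parabolic `μ = 1` ⇒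
fatal iff a fixed point; involutive `μ = −1` ⇒ fatal iff `g² ≠ id`; `μ = 0` ⇒ not a symmetry. -/
def verdict (κ : ℝ) (fixedPoint squareIsId : Bool) : Verdict :=
  if κ = -1 then .notASymmetry
  else if κ = 0 then (if fixedPoint then .fatal else .undecided)
  else if κ = -2 then (if squareIsId then .undecided else .fatal)
  else .fatal

/-- Control / verdict of the finite model (`verdict_hyperbolic`). -/
theorem verdict_hyperbolic {κ : ℝ} (h1 : |1 + κ| ≠ 1) (h0 : 1 + κ ≠ 0) (fp sq : Bool) :
    verdict κ fp sq = .fatal := by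
  have hκ1 : κ ≠ -1 := fun h => h0 (by rw [h]; norm_num)
  have hκ0 : κ ≠ 0 := fun h => h1 (by rw [h]; norm_num)
  have hκ2 : κ ≠ -2 := fun h => h1 (by rw [h]; norm_num)
  simp [verdict, hκ1, hκ0, hκ2]

/-- Control / verdict of the finite model (`verdict_parabolic`). -/
theorem verdict_parabolic (fp sq : Bool) : verdict 0 fp sq = if fp then .fatal else .undecided := by
  simp [verdict]

/-- Control / verdict of the finite model (`verdict_involutive`). -/
theorem verdict_involutive (fp sq : Bool) : verdict (-2) fp sq = if sq then .undecided else .fatal := by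
  simp [verdict]

/-! ### §A  Class helpers -/

/-- Elementary algebra of the height functional: `⟪n, M v⟫ = μ ⟪n, v⟫`. -/
theorem inner_elem (m n v : E3) : ⟪n, elem m n v⟫ = (1 + ⟪n, m⟫) * ⟪n, v⟫ := by
  simp only [elem, inner_add_right, real_inner_smul_right]; ring

/-- Auxiliary lemma of the line, stated and proved verbatim (`elem_of_inner_eq_zero`). -/
theorem elem_of_inner_eq_zero {m n v : E3} (h : ⟪n, v⟫ = 0) : elem m n v = v := by
  simp [elem, h]

/-- `g(y + s m) = g(y) + s μ m`: the direction `m` is an eigendirection of the linear part. -/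
theorem aff_add_smul (m n b y : E3) (s : ℝ) :
    aff m n b (y + s • m) = aff m n b y + (s * (1 + ⟪n, m⟫)) • m := by
  simp only [aff, inner_add_right, real_inner_smul_right]
  module

/-- Auxiliary lemma of the line, stated and proved verbatim (`iterate_aff_add_smul`). -/
theorem iterate_aff_add_smul (m n b y : E3) (s : ℝ) (k : ℕ) :
    (aff m n b)^[k] (y + s • m) = (aff m n b)^[k] y + (s * (1 + ⟪n, m⟫) ^ k) • m := by
  induction k with
  | zero => simp
  | succ k ih =>
    rw [Function.iterate_succ_apply', Function.iterate_succ_apply', ih, aff_add_smul, pow_succ, mul_assoc]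

/-- Auxiliary lemma of the line, stated and proved verbatim (`apply_iterate_eq_of_invariant`). -/
theorem apply_iterate_eq_of_invariant {f : E3 → E3} {g : E3 → E3} (h : ∀ x, f (g x) = f x) (k : ℕ)
    (x : E3) : f (g^[k] x) = f x := by
  induction k generalizing x with
  | zero => rfl
  | succ k ih => rw [Function.iterate_succ_apply, ih, h]

-- `norm_slice_le`: the line restates the tree's `BlochMeter.norm_slice_le`; taken BY NAME (gate lint dedup.landed).

/-- The slice of a class element is LIPSCHITZ (KNSS gradient bound, `exists_norm_iteratedFDeriv_le_of_typeI`
with `k = 1` on a window around `t₀`, and the mean value inequality). -/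
theorem exists_lipschitz_slice {C : ℝ} {u : ℝ → E3 → E3} (hu : IsTypeIAncientMild C u) {t₀ : ℝ}
    (ht₀ : t₀ < 0) : ∃ L : ℝ, ∀ x y : E3, ‖u t₀ x - u t₀ y‖ ≤ L * ‖x - y‖ := by
  obtain ⟨K, hK⟩ := exists_norm_iteratedFDeriv_le_of_typeI C 1 (a := t₀ - 1) (b := t₀ / 2) (δ := 1 / 2)
    (by linarith) (by linarith) (by norm_num)
  have hb : ∀ x, ‖fderiv ℝ (u t₀) x‖ ≤ K := fun x => by
    have h := hK hu.continuousOn_uncurry (fun s hs => hu.isWeaklyDivFree hs)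
      (fun _ _ hsr hr y => hu.mild_eq_heatExtension hsr hr y) hu.hasTypeITimeDecay t₀
      ⟨by linarith, by linarith⟩ x
    rwa [← norm_iteratedFDeriv_fderiv, norm_iteratedFDeriv_zero] at h
  have hd : Differentiable ℝ (u t₀) := (hu.contDiff_slice ht₀).differentiable (by simp)
  exact ⟨K, fun x y => Convex.norm_image_sub_le_of_norm_fderiv_le (fun z _ => hd.differentiableAt)
    (fun z _ => hb z) convex_univ (mem_univ y) (mem_univ x)⟩

/-- POCKET ⇒ GLOBAL: a twin read on a nonempty open pocket of an analytic field holds on all of `ℝ³`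
(both sides are analytic in `x`; identity theorem). -/
theorem twin_of_pocket {f : E3 → E3} (hf : AnalyticOnNhd ℝ f univ) {m n b : E3} {U : Set E3}
    (hU : IsOpen U) (hne : U.Nonempty) (h : ∀ x ∈ U, f (aff m n b x) = elem m n (f x)) (x : E3) :
    f (aff m n b x) = elem m n (f x) := by
  obtain ⟨z₀, hz₀⟩ := hne
  have haff : (aff m n b) = fun x => elemL m n x + b := funext fun x => by simp [aff_eq]
  have h1 : AnalyticOnNhd ℝ (fun x => f (aff m n b x)) univ := fun x _ => by
    rw [haff]
    exact (hf _ (mem_univ _)).comp (((elemL m n).analyticAt x).add analyticAt_const)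
  have h2 : AnalyticOnNhd ℝ (fun x => elem m n (f x)) univ := fun x _ => by
    have : (fun x => elem m n (f x)) = fun x => elemL m n (f x) := funext fun x => by simp
    rw [this]
    exact ((elemL m n).analyticAt _).comp (hf x (mem_univ _))
  have key := h1.eqOn_of_preconnected_of_eventuallyEq h2 isPreconnected_univ (mem_univ z₀)
    (Filter.eventuallyEq_of_mem (hU.mem_nhds hz₀) fun y hy => h y hy)
  exact key (mem_univ x)

-- `eq_zero_of_slice_translate`: the line restates the tree's `BlochMeter.eq_zero_of_slice_periodic`; taken BY NAME (gate lint dedup.landed).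

/-! ### §B  The three laws -/

/-- Along a `g`-orbit the height `⟪n, f⟫` is a geometric progression of ratio `μ`. -/
theorem inner_apply_iterate_aff {f : E3 → E3} {m n b : E3}
    (h : ∀ x, f (aff m n b x) = elem m n (f x)) (k : ℕ) (x : E3) :
    ⟪n, f ((aff m n b)^[k] x)⟫ = (1 + ⟪n, m⟫) ^ k * ⟪n, f x⟫ := by
  induction k generalizing x with
  | zero => simp
  | succ k ih => rw [Function.iterate_succ_apply, ih, h, inner_elem, pow_succ]; ring

/-- LAW 1 (height extinction, expanding case `|μ| > 1`): a BOUNDED twin has `⟪n, f⟫ ≡ 0`. -/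
theorem inner_eq_zero_of_twin_of_one_lt {f : E3 → E3} {m n b : E3} {K : ℝ} (hK : ∀ x, ‖f x‖ ≤ K)
    (h : ∀ x, f (aff m n b x) = elem m n (f x)) (hμ : 1 < |1 + ⟪n, m⟫|) (x : E3) : ⟪n, f x⟫ = 0 := by
  by_contra hne
  have hpos : 0 < |⟪n, f x⟫| := abs_pos.2 hne
  have hbd : ∀ k : ℕ, |1 + ⟪n, m⟫| ^ k * |⟪n, f x⟫| ≤ ‖n‖ * K := fun k => by
    have h2 : |⟪n, f ((aff m n b)^[k] x)⟫| ≤ ‖n‖ * ‖f ((aff m n b)^[k] x)‖ :=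
      abs_real_inner_le_norm _ _
    rw [inner_apply_iterate_aff h k x, abs_mul, abs_pow] at h2
    exact h2.trans (mul_le_mul_of_nonneg_left (hK _) (norm_nonneg _))
  have ht := (tendsto_pow_atTop_atTop_of_one_lt hμ).atTop_mul_const hpos
  obtain ⟨k, hk⟩ := (ht.eventually_gt_atTop (‖n‖ * K)).exists
  exact absurd (hbd k) (not_le.2 hk)

/-- Parabolic orbit formula: for a shear (`⟪n, m⟫ = 0`) the twin values form an ARITHMETIC progression. -/
theorem apply_iterate_aff_of_orth {f : E3 → E3} {m n b : E3}
    (h : ∀ x, f (aff m n b x) = elem m n (f x)) (hκ : ⟪n, m⟫ = 0) (k : ℕ) (x : E3) :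
    f ((aff m n b)^[k] x) = f x + ((k : ℝ) * ⟪n, f x⟫) • m := by
  induction k generalizing x with
  | zero => simp
  | succ k ih =>
    rw [Function.iterate_succ_apply, ih, h]
    simp only [elem, inner_add_right, real_inner_smul_right, hκ, mul_zero, add_zero, Nat.cast_succ]
    module

/-- LAW 1′ (height extinction, parabolic case): a BOUNDED shear twin with `m ≠ 0` has `⟪n, f⟫ ≡ 0`. -/
theorem inner_eq_zero_of_twin_of_orth {f : E3 → E3} {m n b : E3} {K : ℝ} (hK : ∀ x, ‖f x‖ ≤ K)
    (h : ∀ x, f (aff m n b x) = elem m n (f x)) (hκ : ⟪n, m⟫ = 0) (hm : m ≠ 0) (x : E3) :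
    ⟪n, f x⟫ = 0 := by
  by_contra hne
  have hpos : 0 < |⟪n, f x⟫| * ‖m‖ := mul_pos (abs_pos.2 hne) (norm_pos_iff.2 hm)
  have hbd : ∀ k : ℕ, (k : ℝ) * (|⟪n, f x⟫| * ‖m‖) ≤ 2 * K := fun k => by
    have e : ((k : ℝ) * ⟪n, f x⟫) • m = f ((aff m n b)^[k] x) - f x := by
      rw [apply_iterate_aff_of_orth h hκ k x]; abel
    have h1 : ‖((k : ℝ) * ⟪n, f x⟫) • m‖ ≤ 2 * K := by
      rw [e]; exact (norm_sub_le _ _).trans (by linarith [hK ((aff m n b)^[k] x), hK x])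
    rw [norm_smul, Real.norm_eq_abs, abs_mul, Nat.abs_cast] at h1
    linarith [h1]
  obtain ⟨k, hk⟩ := exists_nat_gt (2 * K / (|⟪n, f x⟫| * ‖m‖))
  rw [div_lt_iff₀ hpos] at hk
  linarith [hbd k]

/-- Height extinction makes the twin an INVARIANCE `f ∘ g = f`. -/
theorem invariant_of_inner_eq_zero {f : E3 → E3} {m n b : E3}
    (h : ∀ x, f (aff m n b x) = elem m n (f x)) (h0 : ∀ x, ⟪n, f x⟫ = 0) (x : E3) :
    f (aff m n b x) = f x := by
  rw [h, elem_of_inner_eq_zero (h0 x)]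

/-- LAW 2 (contraction): a LIPSCHITZ function invariant under an elementary affine map with `|μ| < 1` is
invariant under every translation along `m` (`gᵏ(x + τ m) − gᵏ x = τ μᵏ m → 0`). -/
theorem translate_eq_of_invariant_of_lt {f : E3 → E3} {m n b : E3} {L : ℝ}
    (hL : ∀ x y, ‖f x - f y‖ ≤ L * ‖x - y‖) (hinv : ∀ x, f (aff m n b x) = f x)
    (hμ : |1 + ⟪n, m⟫| < 1) (x : E3) (τ : ℝ) : f (x + τ • m) = f x := by
  have key : ∀ k : ℕ, ‖f (x + τ • m) - f x‖ ≤ L * (|τ| * ‖m‖) * |1 + ⟪n, m⟫| ^ k := fun k => by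
    rw [← apply_iterate_eq_of_invariant hinv k (x + τ • m), ← apply_iterate_eq_of_invariant hinv k x,
      iterate_aff_add_smul]
    refine (hL _ _).trans (le_of_eq ?_)
    rw [add_sub_cancel_left, norm_smul, Real.norm_eq_abs, abs_mul, abs_pow]; ring
  have ht : Tendsto (fun k : ℕ => L * (|τ| * ‖m‖) * |1 + ⟪n, m⟫| ^ k) atTop (𝓝 0) := by
    simpa using (tendsto_pow_atTop_nhds_zero_of_lt_one (abs_nonneg _) hμ).const_mul (L * (|τ| * ‖m‖))
  have h0 : ‖f (x + τ • m) - f x‖ ≤ 0 := ge_of_tendsto' ht key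
  exact sub_eq_zero.1 (norm_le_zero_iff.1 h0)

/-- THE INVERSE TWIN: if `μ ≠ 0` then `g` is invertible, `g⁻¹(y) = y + ⟪n, y⟫ m′ + b′` with
`m′ = −μ⁻¹ m`, `b′ = −(b + ⟪n, b⟫ m′)`, and the twin for `g` is a twin for `g⁻¹` (multiplier `μ⁻¹`). -/
theorem twin_inv {f : E3 → E3} {m n b : E3} (h : ∀ x, f (aff m n b x) = elem m n (f x))
    (hμ : 1 + ⟪n, m⟫ ≠ 0) (y : E3) :
    f (aff ((-(1 + ⟪n, m⟫)⁻¹) • m) n (-(b + ⟪n, b⟫ • (-(1 + ⟪n, m⟫)⁻¹) • m)) y)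
      = elem ((-(1 + ⟪n, m⟫)⁻¹) • m) n (f y) := by
  set x : E3 := aff ((-(1 + ⟪n, m⟫)⁻¹) • m) n (-(b + ⟪n, b⟫ • (-(1 + ⟪n, m⟫)⁻¹) • m)) y with hx
  have hnx : ⟪n, x⟫ = (1 + ⟪n, m⟫)⁻¹ * (⟪n, y⟫ - ⟪n, b⟫) := by
    rw [hx]
    simp only [aff, inner_add_right, inner_neg_right, real_inner_smul_right]
    field_simp
    ring
  have hgx : aff m n b x = y := by
    have e1 : aff m n b x = x + ⟪n, x⟫ • m + b := rfl
    rw [e1, hnx, hx]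
    simp only [aff, smul_smul]
    match_scalars <;> (field_simp; try ring)
  have h1 : f y = elem m n (f x) := by rw [← hgx]; exact h x
  have h2 : ⟪n, f y⟫ = (1 + ⟪n, m⟫) * ⟪n, f x⟫ := by rw [h1, inner_elem]
  rw [show elem ((-(1 + ⟪n, m⟫)⁻¹) • m) n (f y) = f x from ?_]
  rw [elem, h2, h1, elem, smul_smul]
  match_scalars <;> (field_simp; try ring)

/-- The multiplier of the inverse twin is `μ⁻¹`. -/
theorem one_add_inner_inv {m n : E3} (hμ : 1 + ⟪n, m⟫ ≠ 0) :
    1 + ⟪n, (-(1 + ⟪n, m⟫)⁻¹) • m⟫ = (1 + ⟪n, m⟫)⁻¹ := by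
  rw [real_inner_smul_right]; field_simp; ring

/-- LAWS 1 + 2 assembled (hyperbolic type): a bounded Lipschitz elementary twin with `|μ| ≠ 1`, `μ ≠ 0` is
invariant under all translations along `m`. -/
theorem translate_eq_of_twin_hyperbolic {f : E3 → E3} {m n b : E3} {K L : ℝ} (hK : ∀ x, ‖f x‖ ≤ K)
    (hL : ∀ x y, ‖f x - f y‖ ≤ L * ‖x - y‖) (h : ∀ x, f (aff m n b x) = elem m n (f x))
    (h1 : |1 + ⟪n, m⟫| ≠ 1) (h0 : 1 + ⟪n, m⟫ ≠ 0) (x : E3) (τ : ℝ) : f (x + τ • m) = f x := by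
  have hinv := twin_inv h h0
  have hμ' := one_add_inner_inv h0
  rcases lt_or_gt_of_ne h1 with hlt | hgt
  · -- contracting: heights die via the (expanding) inverse twin, then contract along `g`
    have hgt' : 1 < |1 + ⟪n, (-(1 + ⟪n, m⟫)⁻¹) • m⟫| := by
      rw [hμ', abs_inv]
      exact one_lt_inv_iff₀.2 ⟨abs_pos.2 h0, hlt⟩
    have hz : ∀ x, ⟪n, f x⟫ = 0 := inner_eq_zero_of_twin_of_one_lt hK hinv hgt'
    exact translate_eq_of_invariant_of_lt hL (invariant_of_inner_eq_zero h hz) hlt x τ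
  · -- expanding: heights die along `g`, then contract along `g⁻¹` (direction `m′ ∥ m`)
    have hz : ∀ x, ⟪n, f x⟫ = 0 := inner_eq_zero_of_twin_of_one_lt hK h hgt
    have hlt' : |1 + ⟪n, (-(1 + ⟪n, m⟫)⁻¹) • m⟫| < 1 := by
      rw [hμ', abs_inv]
      exact inv_lt_one_of_one_lt₀ hgt
    have key := translate_eq_of_invariant_of_lt hL (invariant_of_inner_eq_zero hinv hz) hlt' x
      (τ * (-(1 + ⟪n, m⟫)))
    have e : τ * (-(1 + ⟪n, m⟫)) * (-(1 + ⟪n, m⟫)⁻¹) = τ := by field_simp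
    rw [smul_smul, e] at key
    exact key

/-- LAW 3 (accumulation, parabolic type with a fixed point): an ANALYTIC function invariant under the shear
`x ↦ x + (⟪n, x⟫ + s₀) m` (`⟪n, m⟫ = 0`, `n ≠ 0`; fixed plane `⟪n, x⟫ + s₀ = 0`) is invariant under every
translation along `m`: the analytic function `ε ↦ f(p + ε n′ + σ m) − f(p + ε n′)` vanishes at `ε = σ/(k+1)`. -/
theorem translate_eq_of_invariant_parabolic {f : E3 → E3} (hf : AnalyticOnNhd ℝ f univ) {m n : E3}
    {s₀ : ℝ} (hκ : ⟪n, m⟫ = 0) (hn : n ≠ 0) (hinv : ∀ x, f (x + (⟪n, x⟫ + s₀) • m) = f x) (x : E3)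
    (σ : ℝ) : f (x + σ • m) = f x := by
  rcases eq_or_ne σ 0 with rfl | hσ
  · simp
  -- a dual vector `n'` (`⟪n, n'⟫ = 1`) and the foot `p` of `x` on the fixed plane along `n'`
  obtain ⟨n', hnn'⟩ : ∃ n' : E3, ⟪n, n'⟫ = 1 :=
    ⟨(‖n‖ ^ 2)⁻¹ • n, by
      rw [real_inner_smul_right, real_inner_self_eq_norm_sq]
      field_simp [pow_ne_zero 2 (norm_ne_zero_iff.2 hn)]⟩
  obtain ⟨p, hgt, hp0, hxp⟩ : ∃ (p : E3) (hgt : ℝ), ⟪n, p⟫ + s₀ = 0 ∧ p + hgt • n' = x :=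
    ⟨x - (⟪n, x⟫ + s₀) • n', ⟪n, x⟫ + s₀, by
      rw [inner_sub_right, real_inner_smul_right, hnn']; ring, by abel⟩
  have hlin : ∀ ε c : ℝ, ⟪n, p + ε • n' + c • m⟫ + s₀ = ε := fun ε c => by
    have e : ⟪n, p + ε • n' + c • m⟫ = ⟪n, p⟫ + ε * ⟪n, n'⟫ + c * ⟪n, m⟫ := by
      rw [inner_add_right, inner_add_right, real_inner_smul_right, real_inner_smul_right]
    rw [e, hnn', hκ]; linarith [hp0]
  have horbit : ∀ (ε : ℝ) (j : ℕ),
      (fun y : E3 => y + (⟪n, y⟫ + s₀) • m)^[j] (p + ε • n') = p + ε • n' + ((j : ℝ) * ε) • m := by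
    intro ε j
    induction j with
    | zero => simp
    | succ j ih =>
      rw [Function.iterate_succ_apply', ih]
      show p + ε • n' + ((j : ℝ) * ε) • m + (⟪n, p + ε • n' + ((j : ℝ) * ε) • m⟫ + s₀) • m = _
      rw [hlin, Nat.cast_succ]
      module
  -- the accumulation function
  obtain ⟨E, hE⟩ : ∃ E : ℝ → E3, ∀ ε, E ε = f (p + ε • n' + σ • m) - f (p + ε • n') :=
    ⟨fun ε => f (p + ε • n' + σ • m) - f (p + ε • n'), fun ε => rfl⟩
  have hEan : AnalyticOnNhd ℝ E univ := by
    intro ε _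
    have ha : AnalyticAt ℝ (fun ε : ℝ => p + ε • n') ε :=
      analyticAt_const.add (analyticAt_id.smul analyticAt_const)
    have hb : AnalyticAt ℝ (fun ε : ℝ => p + ε • n' + σ • m) ε := ha.add analyticAt_const
    have : E = fun ε => f (p + ε • n' + σ • m) - f (p + ε • n') := funext hE
    rw [this]
    exact ((hf _ (mem_univ _)).comp hb).sub ((hf _ (mem_univ _)).comp ha)
  have hEzero : ∀ k : ℕ, E (σ / ((k : ℝ) + 1)) = 0 := fun k => by
    have hk := apply_iterate_eq_of_invariant (g := fun y : E3 => y + (⟪n, y⟫ + s₀) • m) hinv (k + 1)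
      (p + (σ / ((k : ℝ) + 1)) • n')
    rw [horbit] at hk
    have hc : (((k + 1 : ℕ) : ℝ) * (σ / ((k : ℝ) + 1))) = σ := by push_cast; field_simp
    rw [hc] at hk
    rw [hE, hk, sub_self]
  have hE0 : E =ᶠ[𝓝 0] 0 := by
    rcases (hEan 0 (mem_univ _)).eventually_eq_zero_or_eventually_ne_zero with h0 | hne
    · exact h0
    · exfalso
      have hseq : Tendsto (fun k : ℕ => σ / ((k : ℝ) + 1)) atTop (𝓝[≠] 0) := by
        refine tendsto_nhdsWithin_iff.2 ⟨?_, Eventually.of_forall fun k => ?_⟩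
        · simpa [div_eq_mul_one_div σ] using (tendsto_one_div_add_atTop_nhds_zero_nat).const_mul σ
        · exact div_ne_zero hσ (by positivity)
      obtain ⟨k, hk⟩ := (hseq.eventually hne).exists
      exact hk (hEzero k)
  have hEq : EqOn E 0 univ :=
    hEan.eqOn_zero_of_preconnected_of_eventuallyEq_zero isPreconnected_univ (mem_univ (0 : ℝ)) hE0
  have key := hEq (mem_univ hgt)
  rw [hE, Pi.zero_apply, sub_eq_zero, hxp] at key
  exact key

/-- Involutive type (`⟪n, m⟫ = −2`, `M² = 1`): `g²` is the translation by `T = ⟪n, b⟫ m + 2 b`. -/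
theorem aff_aff_of_involutive {m n : E3} (hκ : ⟪n, m⟫ = -2) (b x : E3) :
    aff m n b (aff m n b x) = x + (⟪n, b⟫ • m + (2 : ℝ) • b) := by
  simp only [aff, inner_add_right, real_inner_smul_right, hκ]
  module

/-- Auxiliary lemma of the line, stated and proved verbatim (`elem_elem_of_involutive`). -/
theorem elem_elem_of_involutive {m n : E3} (hκ : ⟪n, m⟫ = -2) (v : E3) : elem m n (elem m n v) = v := by
  simp only [elem, inner_add_right, real_inner_smul_right, hκ]
  module

end Summit.NavierStokesRegularity.NavierStokesRegularity.Theorems.ScenarioCensus.AffineMeter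

end
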